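import Mathlib
import Literature.Analysis.FluidPDE.VectorCalculus
import Literature.Analysis.FluidPDE.WholeSpaceIBP

/-!
# Classical DSS flux rigidity, part 2/4: transport of the Bernoulli head, integration by parts
off the origin

Support file (cdisprove seat, crux `PointSink.PointFluxCone`, stmt-AnomalousDissipation-19033) for
`Theorems/PointFluxCone/Negative/ClassicalFluxRigidity.lean`.

Contents: (i) a field `W ∈ C¹(ℝ³ ∖ {0})` with `div W = 0` off the origin is weakly divergence free
against `C¹_c` tests vanishing near `0` (smooth radial cut-off + the tree's whole-space identity
`∫ θ div u + ∫ ⟪u, ∇θ⟫ = 0`, `WholeSpaceIBP`); (ii) BERNOULLI: for a pointwise steady Euler pair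
the head `B = ½|V|² + P` has `DB[V] = ⟪V, (V·∇)V + ∇P⟫ = 0`, hence `div (h(B) V) = 0` off the
origin for every `C¹` profile `h`; (iii) continuity / compact support / integrability of radially
weighted integrands `F(x) ζ(‖x‖²)` with `F` continuous off the origin and `ζ` supported in
`[a, b] ⊂ (0, ∞)`. [folklore]
-/

set_option linter.dupNamespace false  -- `Summit.AnomalousDissipation.AnomalousDissipation` is the mandated summit/problem namespace

noncomputable section

open MeasureTheory Metric Filter Topology Set Function
open scoped InnerProductSpace RealInnerProductSpace
open Literature.Analysis.FluidPDE

namespace Summit.AnomalousDissipation.AnomalousDissipation.Theorems.PointFluxCone.Negative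

/-! ## Integration by parts off the origin

A field `W` that is `C¹` and divergence free on `ℝ³ ∖ {0}` is weakly divergence free against
`C¹` compactly supported tests vanishing near the origin: multiply `W` by a smooth radial cut-off
that is `0` near `0` and `1` on the support of the test, and apply the whole-space identity
`∫ θ div u + ∫ ⟪u, ∇θ⟫ = 0` of the tree (`WholeSpaceIBP`). -/

section IBP

/-- **Weak divergence-freeness off the origin.** If `W ∈ C¹(ℝ³ ∖ {0})` has `div W = 0` off the
origin and `θ ∈ C¹_c(ℝ³)` vanishes near the origin, then `∫ ⟪W, ∇θ⟫ = 0`. [folklore] -/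
theorem integral_inner_gradient_eq_zero_off_zero
    {W : (EuclideanSpace ℝ (Fin 3)) → (EuclideanSpace ℝ (Fin 3))} {θ : (EuclideanSpace ℝ (Fin 3)) → ℝ}
    (hW : ContDiffOn ℝ 1 W {x | x ≠ 0})
    (hdivW : ∀ x : (EuclideanSpace ℝ (Fin 3)), x ≠ 0 → VectorCalculus.divergence W x = 0)
    (hθ : ContDiff ℝ 1 θ) (hθc : HasCompactSupport θ)
    (hθ0 : (0 : (EuclideanSpace ℝ (Fin 3))) ∉ tsupport θ) :
    ∫ x, ⟪W x, gradient θ x⟫ = 0 := by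
  -- a ball around `0` missing the support of `θ`
  obtain ⟨ε, hε, hball⟩ := Metric.isOpen_iff.1 (isClosed_tsupport θ).isOpen_compl 0 hθ0
  -- a smooth radial cut-off: `0` on `‖x‖ ≤ ε/2`, `1` on `‖x‖² ≥ ε²/2`
  set χ : (EuclideanSpace ℝ (Fin 3)) → ℝ :=
    fun x => Real.smoothTransition (4 * ‖x‖ ^ 2 / ε ^ 2 - 1) with hχ
  have hχC : ContDiff ℝ 1 χ := by
    have h1 : ContDiff ℝ 1 (fun x : EuclideanSpace ℝ (Fin 3) => 4 * ‖x‖ ^ 2 / ε ^ 2 - 1) :=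
      ((contDiff_const.mul (contDiff_norm_sq ℝ)).div_const _).sub contDiff_const
    exact (Real.smoothTransition.contDiff (n := 1)).comp h1
  have hχ0 : ∀ x : EuclideanSpace ℝ (Fin 3), ‖x‖ ≤ ε / 2 → χ x = 0 := fun x hx => by
    refine Real.smoothTransition.zero_of_nonpos ?_
    rw [sub_nonpos, div_le_one (by positivity)]
    nlinarith [norm_nonneg x]
  have hχ1 : ∀ x : EuclideanSpace ℝ (Fin 3), ε ^ 2 / 2 ≤ ‖x‖ ^ 2 → χ x = 1 := fun x hx => by
    refine Real.smoothTransition.one_of_one_le ?_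
    rw [le_sub_iff_add_le, le_div_iff₀ (by positivity)]
    linarith
  -- the globalised field
  set U : (EuclideanSpace ℝ (Fin 3)) → (EuclideanSpace ℝ (Fin 3)) := fun x => χ x • W x with hU
  have hUC : ContDiff ℝ 1 U := by
    rw [contDiff_iff_contDiffAt]
    intro x
    by_cases hx : ‖x‖ < ε / 2
    · have hev : U =ᶠ[𝓝 x] fun _ => 0 := by
        filter_upwards [(isOpen_lt continuous_norm continuous_const).mem_nhds hx] with y hy
        simp [hU, hχ0 y (le_of_lt hy)]
      exact contDiffAt_const.congr_of_eventuallyEq hev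
    · have hx0 : x ≠ 0 := by
        intro h; apply hx; rw [h, norm_zero]; positivity
      exact (hχC.contDiffAt).smul (hW.contDiffAt (isOpen_ne.mem_nhds hx0))
  -- `U = W` near every point with `‖x‖ ≥ ε`
  have hUW : ∀ x : (EuclideanSpace ℝ (Fin 3)), ε ≤ ‖x‖ → U =ᶠ[𝓝 x] W := by
    intro x hx
    have hlt : ε ^ 2 / 2 < ‖x‖ ^ 2 := by nlinarith
    filter_upwards [(isOpen_lt continuous_const (continuous_norm.pow 2)).mem_nhds hlt] with y hy
    simp [hU, hχ1 y (le_of_lt hy)]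
  have key := integral_mul_divergence_add_eq_zero_left hθ hUC hθc
  -- the first integral vanishes identically
  have h1 : (fun x => θ x * VectorCalculus.divergence U x) = fun _ => 0 := by
    funext x
    by_cases hx : ‖x‖ < ε
    · have hxs : x ∉ tsupport θ := fun h => hball (by simpa using hx) h
      rw [image_eq_zero_of_notMem_tsupport hxs, zero_mul]
    · have hx' : ε ≤ ‖x‖ := not_lt.1 hx
      have hx0 : x ≠ 0 := by
        intro h; rw [h, norm_zero] at hx'; exact absurd hx' (not_le.2 hε)
      have : VectorCalculus.divergence U x = VectorCalculus.divergence W x := by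
        simp only [VectorCalculus.divergence, (hUW x hx').fderiv_eq]
      rw [this, hdivW x hx0, mul_zero]
  -- the second integrand agrees with `⟪W, ∇θ⟫`
  have h2 : (fun x => ⟪U x, gradient θ x⟫) = fun x => ⟪W x, gradient θ x⟫ := by
    funext x
    by_cases hx : ‖x‖ < ε
    · have hxs : x ∉ tsupport θ := fun h => hball (by simpa using hx) h
      rw [gradient_eq_zero_of_notMem_tsupport hxs, inner_zero_right, inner_zero_right]
    · have hx' : ε ≤ ‖x‖ := not_lt.1 hx
      rw [show U x = W x from (hUW x hx').self_of_nhds]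
  rw [h1, h2] at key
  simpa using key

end IBP

/-! ## The Bernoulli head is transported; renormalised fields are divergence free -/

section Bernoulli

variable {V : (EuclideanSpace ℝ (Fin 3)) → (EuclideanSpace ℝ (Fin 3))} {P : (EuclideanSpace ℝ (Fin 3)) → ℝ}

/-- Derivative of the head: `DB = ⟪V, DV ·⟫ + DP`. [folklore] -/
theorem head_hasFDerivAt {x : (EuclideanSpace ℝ (Fin 3))} (hV : DifferentiableAt ℝ V x) (hP : DifferentiableAt ℝ P x) :
    HasFDerivAt (fun y => ‖V y‖ ^ 2 / 2 + P y)
      ((2⁻¹ : ℝ) • ((2 : ℕ) • ((innerSL ℝ (V x)).comp (fderiv ℝ V x))) + fderiv ℝ P x) x := by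
  have h1 : HasFDerivAt (fun y => ‖V y‖ ^ 2) ((2 : ℕ) • ((innerSL ℝ (V x)).comp (fderiv ℝ V x))) x := by
    have := hV.hasFDerivAt.norm_sq
    simpa using this
  have h2 := (h1.const_smul (2⁻¹ : ℝ)).add hP.hasFDerivAt
  refine h2.congr_of_eventuallyEq (Eventually.of_forall fun y => ?_)
  simp only [Pi.add_apply, Pi.smul_apply, smul_eq_mul]
  ring

/-- The head is differentiable where `V` and `P` are. [folklore] -/
theorem differentiableAt_head {x : (EuclideanSpace ℝ (Fin 3))} (hV : DifferentiableAt ℝ V x) (hP : DifferentiableAt ℝ P x) :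
    DifferentiableAt ℝ (fun y => ‖V y‖ ^ 2 / 2 + P y) x :=
  (head_hasFDerivAt hV hP).differentiableAt

/-- `DB(x)[v] = ⟪V x, DV(x) v⟫ + DP(x) v`. [folklore] -/
theorem fderiv_head_apply {x : (EuclideanSpace ℝ (Fin 3))} (hV : DifferentiableAt ℝ V x) (hP : DifferentiableAt ℝ P x)
    (v : (EuclideanSpace ℝ (Fin 3))) :
    fderiv ℝ (fun y => ‖V y‖ ^ 2 / 2 + P y) x v = ⟪V x, fderiv ℝ V x v⟫ + fderiv ℝ P x v := by
  rw [(head_hasFDerivAt hV hP).fderiv, _root_.add_apply, _root_.smul_apply, _root_.smul_apply,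
    ContinuousLinearMap.comp_apply, innerSL_apply_apply]
  simp only [nsmul_eq_mul, Nat.cast_ofNat, smul_eq_mul]
  ring

/-- **Bernoulli**: for a pointwise steady Euler pair, `DB(x)[V x] = ⟪V, (V·∇)V + ∇P⟫ = 0`. [folklore] -/
theorem fderiv_head_apply_self {x : (EuclideanSpace ℝ (Fin 3))} (hV : DifferentiableAt ℝ V x) (hP : DifferentiableAt ℝ P x)
    (hmom : convect V V x + gradient P x = 0) :
    fderiv ℝ (fun y => ‖V y‖ ^ 2 / 2 + P y) x (V x) = 0 := by
  rw [fderiv_head_apply hV hP]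
  have hP' : fderiv ℝ P x (V x) = ⟪gradient P x, V x⟫ := by
    rw [gradient, InnerProductSpace.toDual_symm_apply]
  rw [hP', ← real_inner_comm (gradient P x) (V x), ← inner_add_right, ← convect_apply, hmom,
    inner_zero_right]

/-- The head is `C¹` off the origin. [folklore] -/
theorem contDiffOn_head (hV : ContDiffOn ℝ 1 V {x | x ≠ 0}) (hP : ContDiffOn ℝ 1 P {x | x ≠ 0}) :
    ContDiffOn ℝ 1 (fun y => ‖V y‖ ^ 2 / 2 + P y) {x | x ≠ 0} :=
  ((hV.norm_sq ℝ).div_const 2).add hP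

/-- The head is continuous off the origin. [folklore] -/
theorem continuousOn_head (hV : ContDiffOn ℝ 1 V {x | x ≠ 0}) (hP : ContDiffOn ℝ 1 P {x | x ≠ 0}) :
    ContinuousOn (fun y => ‖V y‖ ^ 2 / 2 + P y) {x | x ≠ 0} :=
  (contDiffOn_head hV hP).continuousOn

/-- **Renormalised transport is divergence free**: for a `C¹` profile `h` with derivative `w`
and a pointwise steady Euler pair, `div (h(B) V) = h'(B) DB[V] + h(B) div V = 0` off the origin. [folklore] -/
theorem divergence_head_smul_eq_zero {h w : ℝ → ℝ} (hh : ∀ s, HasDerivAt h (w s) s)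
    {x : (EuclideanSpace ℝ (Fin 3))}
    (hV : DifferentiableAt ℝ V x) (hP : DifferentiableAt ℝ P x)
    (hdiv : VectorCalculus.divergence V x = 0) (hmom : convect V V x + gradient P x = 0) :
    VectorCalculus.divergence (fun y => h (‖V y‖ ^ 2 / 2 + P y) • V y) x = 0 := by
  have hB : DifferentiableAt ℝ (fun y => ‖V y‖ ^ 2 / 2 + P y) x := differentiableAt_head hV hP
  have hθ0 : HasFDerivAt (h ∘ fun y => ‖V y‖ ^ 2 / 2 + P y)
      (w (‖V x‖ ^ 2 / 2 + P x) • fderiv ℝ (fun y => ‖V y‖ ^ 2 / 2 + P y) x) x :=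
    (hh (‖V x‖ ^ 2 / 2 + P x)).comp_hasFDerivAt x hB.hasFDerivAt
  have hθ : HasFDerivAt (fun y => h (‖V y‖ ^ 2 / 2 + P y))
      (w (‖V x‖ ^ 2 / 2 + P x) • fderiv ℝ (fun y => ‖V y‖ ^ 2 / 2 + P y) x) x := hθ0
  rw [divergence_smul_apply hθ.differentiableAt hV, hdiv, mul_zero, zero_add, real_inner_comm,
    gradient, InnerProductSpace.toDual_symm_apply, hθ.fderiv, _root_.smul_apply,
    fderiv_head_apply_self hV hP hmom, smul_zero]

/-- The renormalised field `h(B) V` is `C¹` off the origin. [folklore] -/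
theorem contDiffOn_head_smul {h : ℝ → ℝ} (hh : ContDiff ℝ 1 h) (hV : ContDiffOn ℝ 1 V {x | x ≠ 0})
    (hP : ContDiffOn ℝ 1 P {x | x ≠ 0}) :
    ContDiffOn ℝ 1 (fun y => h (‖V y‖ ^ 2 / 2 + P y) • V y) {x | x ≠ 0} :=
  (hh.comp_contDiffOn (contDiffOn_head hV hP)).smul hV

end Bernoulli


/-! ## Radially weighted integrands: continuity and integrability -/

section Weighted

/-- If `F` is continuous off the origin and `ζ` vanishes on `(-∞, a]`, `a > 0`, then
`x ↦ F x · ζ(‖x‖²)` is continuous on all of `ℝ³`. [folklore] -/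
theorem continuous_mul_radial {F : (EuclideanSpace ℝ (Fin 3)) → ℝ} (hF : ContinuousOn F {x | x ≠ 0}) {ζ : ℝ → ℝ}
    (hζ : Continuous ζ) {a : ℝ} (ha : 0 < a) (hζa : ∀ u, u ≤ a → ζ u = 0) :
    Continuous fun x => F x * ζ (‖x‖ ^ 2) := by
  rw [continuous_iff_continuousAt]
  intro x
  by_cases hx : ‖x‖ ^ 2 < a
  · have hev : (fun y : (EuclideanSpace ℝ (Fin 3)) => F y * ζ (‖y‖ ^ 2)) =ᶠ[𝓝 x] fun _ => 0 := by
      have ho : IsOpen {y : (EuclideanSpace ℝ (Fin 3)) | ‖y‖ ^ 2 < a} := isOpen_lt (continuous_norm.pow 2) continuous_const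
      filter_upwards [ho.mem_nhds hx] with y hy
      rw [hζa _ (le_of_lt hy), mul_zero]
    exact (continuousAt_congr hev).2 continuousAt_const
  · have hx0 : x ≠ 0 := by
      intro h; apply hx; rw [h, norm_zero]; simpa using ha
    exact (hF.continuousAt (isOpen_ne.mem_nhds hx0)).mul
      ((hζ.comp (continuous_norm.pow 2)).continuousAt)

/-- If `ζ` vanishes on `[b, ∞)` then `x ↦ F x · ζ(‖x‖²)` has compact support. [folklore] -/
theorem hasCompactSupport_mul_radial (F : (EuclideanSpace ℝ (Fin 3)) → ℝ) {ζ : ℝ → ℝ} {b : ℝ} (hb : 0 ≤ b)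
    (hζb : ∀ u, b ≤ u → ζ u = 0) : HasCompactSupport fun x => F x * ζ (‖x‖ ^ 2) := by
  refine HasCompactSupport.intro (isCompact_closedBall (0 : (EuclideanSpace ℝ (Fin 3))) (Real.sqrt b)) fun x hx => ?_
  rw [mem_closedBall, dist_zero_right, not_le] at hx
  have h0 : 0 ≤ Real.sqrt b := Real.sqrt_nonneg _
  have : b ≤ ‖x‖ ^ 2 := by
    calc b = Real.sqrt b ^ 2 := (Real.sq_sqrt hb).symm
      _ ≤ ‖x‖ ^ 2 := by gcongr
  simp [hζb _ this]

/-- `x ↦ F x · ζ(‖x‖²)` is integrable (continuous with compact support). [folklore] -/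
theorem integrable_mul_radial {F : (EuclideanSpace ℝ (Fin 3)) → ℝ} (hF : ContinuousOn F {x | x ≠ 0}) {ζ : ℝ → ℝ}
    (hζ : Continuous ζ) {a b : ℝ} (ha : 0 < a) (hab : a ≤ b) (hζa : ∀ u, u ≤ a → ζ u = 0)
    (hζb : ∀ u, b ≤ u → ζ u = 0) : Integrable fun x => F x * ζ (‖x‖ ^ 2) :=
  (continuous_mul_radial hF hζ ha hζa).integrable_of_hasCompactSupport
    (hasCompactSupport_mul_radial F (ha.le.trans hab) hζb)

end Weighted

end Summit.AnomalousDissipation.AnomalousDissipation.Theorems.PointFluxCone.Negative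

end
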